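import Mathlib.RingTheory.Polynomial.UniqueFactorization
import Mathlib.Algebra.MvPolynomial.NoZeroDivisors
import Mathlib.Algebra.MvPolynomial.Nilpotent
import Mathlib.Tactic.LinearCombination
import Mathlib.Tactic.Linarith
import Literature.RingTheory.MvPolynomial.RuppertMatrix
import HarnessLib

/-!
# Ruppert's criterion, easy direction: a non-irreducible `φ` has two independent kernel pairs

Sibling proof file of `RuppertMatrix.lean` (W. M. Ruppert, *Reducibility of polynomials `f(x, y)`
modulo `p`*, J. Number Theory 77 (1999) 62–70, Lemma 1: "Let `k` be an arbitrary algebraically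
closed field and `f(x, y) ∈ k[x, y]` a reducible polynomial … Then there are polynomials `r, s`
… such that `∂/∂y (r/f) = ∂/∂x (s/f)` and `(r, s) ≠ (0, 0)`", with the proof of §3: Case I
(`f = gh` squarefree: `r = ∂g/∂x · h`, `s = ∂g/∂y · h` up to the combination with `g ∂h`),
Case II (`f = g²h`: `r = h ∂g/∂x`, `s = h ∂g/∂y`, "`r/f = ∂/∂x(−1/g)`")).

## What is proved (no definitions, no named facts)

In the total-degree normalisation of `RuppertMatrix.lean` (unknown pairs `(G, H)` with
`deg G, deg H ≤ d − 1`), where `(φ_X, φ_Y)` is always in the kernel of `R_φ`: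

* `Ruppert.two_kernel_pairs_of_not_irreducible` — over a field in which `1, …, d` are
  invertible, if `deg φ ≤ d` and `φ` is NOT irreducible (zero, a unit, or a proper product) then
  the kernel of `R_φ` contains two linearly independent pairs. The pairs are Ruppert's: for
  `φ = w t` with `w` irreducible, `w ∤ t`: `(t w_X, t w_Y)` and `(w t_X, w t_Y)`; for
  `φ = wᵉ t`, `e ≥ 2`, `w ∤ t`: `(φ_X, φ_Y)` and `(t w_X, t w_Y)`; for `φ` constant: `(1, 0)` and
  `(0, 1)`. The hypothesis on the characteristic replaces Ruppert's "algebraically closed" (it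
  guarantees that a non-constant polynomial of degree `≤ d` has a non-zero partial derivative).

## References

* W. M. Ruppert, J. Number Theory 77 (1999) 62–70, §2 Lemma 1, §3. [`Ruppert1999`]
-/

noncomputable section

open MvPolynomial

namespace Literature.RingTheory.MvPolynomial

namespace Ruppert

variable {F : Type*} [Field F]

/-! ### Degrees -/

/-- A partial derivative lowers the total degree by one (or kills the polynomial). [folklore] -/
theorem totalDegree_pderiv_le {σ R : Type*} [CommRing R] (i : σ) (p : MvPolynomial σ R) :
    (pderiv i p).totalDegree ≤ p.totalDegree - 1 := by
  refine Finset.sup_le fun m hm => ?_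
  rw [mem_support_iff, coeff_pderiv] at hm
  have hm' : coeff (m + Finsupp.single i 1) p ≠ 0 := fun h => hm (by rw [h, zero_mul])
  have h := le_totalDegree (mem_support_iff.mpr hm')
  have hsum : ((m + Finsupp.single i 1).sum fun _ e => e) = (m.sum fun _ e => e) + 1 := by
    change (m + Finsupp.single i 1).degree = m.degree + 1
    rw [map_add, Finsupp.degree_single]
  rw [hsum] at h
  change m.degree ≤ p.totalDegree - 1
  change m.degree + 1 ≤ p.totalDegree at h
  omega

/-- Over a domain, `deg (wᵉ) = e · deg w` for `w ≠ 0`. [folklore] -/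
theorem totalDegree_pow_of_ne_zero {σ R : Type*} [CommRing R] [IsDomain R] {w : MvPolynomial σ R}
    (hw : w ≠ 0) (e : ℕ) : (w ^ e).totalDegree = e * w.totalDegree := by
  induction e with
  | zero => simp
  | succ n ih => rw [pow_succ, totalDegree_mul_of_isDomain (pow_ne_zero _ hw) hw, ih]; ring

/-- A non-constant polynomial does not divide its own partial derivatives (unless they vanish).
[folklore] -/
theorem pderiv_eq_zero_of_dvd {w : MvPolynomial (Fin 2) F} (hw : 0 < w.totalDegree) (i : Fin 2)
    (h : w ∣ pderiv i w) : pderiv i w = 0 := by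
  by_contra hne
  have h1 := totalDegree_le_of_dvd_of_isDomain h hne
  have h2 := totalDegree_pderiv_le i w
  omega

/-- **Non-constant polynomials of small degree have a non-zero gradient**: if `1, …, d` are
non-zero in `F`, `0 < deg p ≤ d`, then `p_X ≠ 0` or `p_Y ≠ 0`. (Replaces Ruppert's remark "if
`∂g/∂x = ∂g/∂y = 0` then `g` is constant in characteristic `0` or a `p`-power".) [cite: Ruppert1999, §3 (opening remark)] -/
theorem pderiv_ne_zero_of_totalDegree_pos {d : ℕ} (hchar : ∀ a : ℕ, 0 < a → a ≤ d → (a : F) ≠ 0)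
    {p : MvPolynomial (Fin 2) F} (hpos : 0 < p.totalDegree) (hdeg : p.totalDegree ≤ d) :
    pderiv 0 p ≠ 0 ∨ pderiv 1 p ≠ 0 := by
  classical
  -- a monomial of top degree
  have hne : p.support.Nonempty := by
    rw [Finset.nonempty_iff_ne_empty, Ne, support_eq_empty]
    rintro rfl
    simp at hpos
  obtain ⟨m, hm, hmax⟩ := Finset.exists_mem_eq_sup p.support hne (fun s => s.sum fun _ e => e)
  change p.totalDegree = m.degree at hmax
  have hdm : m.degree = m 0 + m 1 := degree_fin_two m
  have hcoeff : coeff m p ≠ 0 := mem_support_iff.mp hm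
  by_cases h0 : 0 < m 0
  · left
    intro hzero
    have h := congrArg (coeff (m - Finsupp.single 0 1)) hzero
    rw [coeff_pderiv, coeff_zero, tsub_add_cancel_of_le
      (Finsupp.single_le_iff.mpr h0)] at h
    refine mul_ne_zero hcoeff ?_ h
    have : ((m - Finsupp.single (0 : Fin 2) 1 : Fin 2 →₀ ℕ) 0 + 1 : ℕ) = m 0 := by
      simp only [Finsupp.tsub_apply, Finsupp.single_eq_same]; omega
    exact_mod_cast hchar _ (by omega)
      (by omega : ((m - Finsupp.single (0 : Fin 2) 1 : Fin 2 →₀ ℕ) 0 + 1) ≤ d)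
  · right
    have h1 : 0 < m 1 := by omega
    intro hzero
    have h := congrArg (coeff (m - Finsupp.single 1 1)) hzero
    rw [coeff_pderiv, coeff_zero, tsub_add_cancel_of_le
      (Finsupp.single_le_iff.mpr h1)] at h
    refine mul_ne_zero hcoeff ?_ h
    have : ((m - Finsupp.single (1 : Fin 2) 1 : Fin 2 →₀ ℕ) 1 + 1 : ℕ) = m 1 := by
      simp only [Finsupp.tsub_apply, Finsupp.single_eq_same]; omega
    exact_mod_cast hchar _ (by omega)
      (by omega : ((m - Finsupp.single (1 : Fin 2) 1 : Fin 2 →₀ ℕ) 1 + 1) ≤ d)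

/-! ### The kernel pairs attached to a factorisation -/

/-- **Ruppert's Case I pair**: for `φ = w t`, the pair `(t w_X, t w_Y)` (the form `dw/w`) lies in
the kernel of `R_φ`. [cite: Ruppert1999, §3 (proof of Lemma 1, Case I)] -/
theorem rupOp_logPair (w t : MvPolynomial (Fin 2) F) :
    rupOp (w * t) (t * pderiv 0 w) (t * pderiv 1 w) = 0 := by
  simp only [rupOp, Derivation.leibniz, smul_eq_mul, pderiv_zero_pderiv_one]
  ring

/-- **Ruppert's Case II pair**: for `φ = wᵉ t`, the pair `(t w_X, t w_Y)` (the form `w^{−e} dw`)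
lies in the kernel of `R_φ`. [cite: Ruppert1999, §3 (proof of Lemma 1, Case II)] -/
theorem rupOp_powPair (w t : MvPolynomial (Fin 2) F) (e : ℕ) :
    rupOp (w ^ e * t) (t * pderiv 0 w) (t * pderiv 1 w) = 0 := by
  simp only [rupOp, Derivation.leibniz, Derivation.leibniz_pow, smul_eq_mul, nsmul_eq_mul,
    pderiv_zero_pderiv_one]
  ring

/-! ### Maximal powers of an irreducible factor -/

/-- **Maximal power**: a non-constant divisor `w` of `φ ≠ 0` divides it to a maximal power:
`φ = wᵉ t` with `e ≥ 1` and `w ∤ t`. [folklore] -/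
theorem exists_max_pow_dvd {w φ : MvPolynomial (Fin 2) F} (hw : 0 < w.totalDegree) (hφ : φ ≠ 0)
    (hdvd : w ∣ φ) : ∃ e : ℕ, 1 ≤ e ∧ ∃ t, φ = w ^ e * t ∧ ¬ w ∣ t := by
  classical
  -- powers dividing `φ` are bounded by the degree
  have hw0 : w ≠ 0 := fun h0 => by rw [h0, totalDegree_zero] at hw; exact lt_irrefl _ hw
  have hbound : ∀ e, w ^ e ∣ φ → e ≤ φ.totalDegree := by
    intro e he
    have h := totalDegree_le_of_dvd_of_isDomain he hφ
    rw [totalDegree_pow_of_ne_zero hw0] at h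
    nlinarith
  set e := Nat.findGreatest (fun e => w ^ e ∣ φ) φ.totalDegree with he_def
  have he1 : 1 ≤ e := Nat.le_findGreatest (hbound 1 (by rwa [pow_one])) (by rwa [pow_one])
  have hespec : w ^ e ∣ φ := by
    have := Nat.findGreatest_spec (P := fun e => w ^ e ∣ φ) (hbound 1 (by rwa [pow_one]))
      (by rwa [pow_one])
    exact this
  have hnot : ¬ w ^ (e + 1) ∣ φ := by
    intro h
    have hle := hbound _ h
    exact Nat.findGreatest_is_greatest (Nat.lt_succ_self e) hle h
  obtain ⟨t, ht⟩ := hespec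
  refine ⟨e, he1, t, ht, fun hwt => hnot ?_⟩
  obtain ⟨s, hs⟩ := hwt
  exact ⟨s, by rw [ht, hs, pow_succ]; ring⟩

/-! ### The theorem -/

/-- Constant `φ` (zero or a unit): the pairs `(1, 0)` and `(0, 1)` are independent kernel pairs. [folklore] -/
theorem two_kernel_pairs_of_C (c : F) (d : ℕ) :
    ∃ G₁ H₁ G₂ H₂ : MvPolynomial (Fin 2) F,
      G₁.totalDegree ≤ d - 1 ∧ H₁.totalDegree ≤ d - 1 ∧ G₂.totalDegree ≤ d - 1 ∧
        H₂.totalDegree ≤ d - 1 ∧ rupOp (C c) G₁ H₁ = 0 ∧ rupOp (C c) G₂ H₂ = 0 ∧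
        ∀ a b : F, a • G₁ + b • G₂ = 0 → a • H₁ + b • H₂ = 0 → a = 0 ∧ b = 0 := by
  refine ⟨1, 0, 0, 1, by simp, by simp, by simp, by simp, ?_, ?_, fun a b h1 h2 => ?_⟩
  · simp [rupOp]
  · simp [rupOp]
  · simp only [smul_zero, add_zero, zero_add] at h1 h2
    rw [smul_eq_C_mul, mul_one, C_eq_zero] at h1 h2
    exact ⟨h1, h2⟩

/-- **Ruppert's Lemma 1 (kernel version).** Let `F` be a field in which `1, 2, …, d` are non-zero
and `φ ∈ F[X, Y]` with `deg φ ≤ d`. If `φ` is NOT irreducible (zero, a unit, or a product of two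
non-units), then there are two `F`-linearly independent pairs `(G₁, H₁)`, `(G₂, H₂)` with
`deg Gᵢ, deg Hᵢ ≤ d − 1` and `R_φ(Gᵢ, Hᵢ) = 0`. [cite: Ruppert1999, §2 Lemma 1, §3 (proof of Lemma 1)] -/
theorem two_kernel_pairs_of_not_irreducible {d : ℕ}
    (hchar : ∀ a : ℕ, 0 < a → a ≤ d → (a : F) ≠ 0) {φ : MvPolynomial (Fin 2) F}
    (hdeg : φ.totalDegree ≤ d) (hφ : ¬ Irreducible φ) :
    ∃ G₁ H₁ G₂ H₂ : MvPolynomial (Fin 2) F,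
      G₁.totalDegree ≤ d - 1 ∧ H₁.totalDegree ≤ d - 1 ∧ G₂.totalDegree ≤ d - 1 ∧
        H₂.totalDegree ≤ d - 1 ∧ rupOp φ G₁ H₁ = 0 ∧ rupOp φ G₂ H₂ = 0 ∧
        ∀ a b : F, a • G₁ + b • G₂ = 0 → a • H₁ + b • H₂ = 0 → a = 0 ∧ b = 0 := by
  classical
  -- constant `φ`
  by_cases hconst : φ.totalDegree = 0
  · obtain ⟨c, rfl⟩ : ∃ c, φ = C c := ⟨_, (totalDegree_eq_zero_iff_eq_C).mp hconst⟩
    exact two_kernel_pairs_of_C c d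
  have hpos : 0 < φ.totalDegree := Nat.pos_of_ne_zero hconst
  have hφ0 : φ ≠ 0 := fun h => by rw [h, totalDegree_zero] at hpos; exact lt_irrefl _ hpos
  have hφu : ¬ IsUnit φ := fun hu => by
    rw [MvPolynomial.isUnit_iff_totalDegree_of_isReduced] at hu
    omega
  -- a proper factorisation and an irreducible factor `w` of the first factor
  obtain ⟨u, v, huv, hu, hv⟩ : ∃ u v, φ = u * v ∧ ¬ IsUnit u ∧ ¬ IsUnit v := by
    by_contra hall
    push Not at hall
    exact hφ (irreducible_iff.mpr ⟨hφu, fun a b h => by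
      by_contra hab; push Not at hab; exact hab.2 (hall a b h hab.1)⟩)
  have hu0 : u ≠ 0 := fun h => hφ0 (by rw [huv, h, zero_mul])
  have hv0 : v ≠ 0 := fun h => hφ0 (by rw [huv, h, mul_zero])
  obtain ⟨w, hwirr, hwu⟩ := WfDvdMonoid.exists_irreducible_factor hu hu0
  have hwprime : Prime w := hwirr.prime
  have hw0 : w ≠ 0 := hwirr.ne_zero
  have hwpos : 0 < w.totalDegree := by
    by_contra h
    have h0 : w.totalDegree = 0 := by omega
    obtain ⟨c, hc⟩ : ∃ c, w = C c := ⟨_, (totalDegree_eq_zero_iff_eq_C).mp h0⟩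
    have hc0 : c ≠ 0 := by rintro rfl; exact hw0 (by rw [hc, C_0])
    exact hwirr.not_isUnit (by rw [hc]; exact (Ne.isUnit hc0).map C)
  have hwφ : w ∣ φ := hwu.trans ⟨v, huv⟩
  -- the gradient of `w` does not vanish, and `w` divides neither partial
  have hwdeg : w.totalDegree ≤ d := (totalDegree_le_of_dvd_of_isDomain hwφ hφ0).trans hdeg
  have hwgrad := pderiv_ne_zero_of_totalDegree_pos hchar hwpos hwdeg
  have hwndvd : ∀ i : Fin 2, w ∣ pderiv i w → pderiv i w = 0 := fun i => pderiv_eq_zero_of_dvd hwpos i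
  -- maximal power of `w` in `φ`
  obtain ⟨e, he1, t, hφt, hwt⟩ := exists_max_pow_dvd hwpos hφ0 hwφ
  have ht0 : t ≠ 0 := fun h => hφ0 (by rw [hφt, h, mul_zero])
  have hwe0 : w ^ e ≠ 0 := pow_ne_zero _ hw0
  -- degree bookkeeping: `deg φ = e deg w + deg t ≥ deg w + deg t`
  have hpow : (w ^ e).totalDegree = e * w.totalDegree := totalDegree_pow_of_ne_zero hw0 e
  have hdegφ : φ.totalDegree = e * w.totalDegree + t.totalDegree := by
    rw [hφt, totalDegree_mul_of_isDomain hwe0 ht0, hpow]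
  have hwt_deg : t.totalDegree + w.totalDegree ≤ φ.totalDegree := by
    rw [hdegφ]; nlinarith
  -- the common second pair `(t w_X, t w_Y)`
  have hdeg2 : ∀ i : Fin 2, (t * pderiv i w).totalDegree ≤ d - 1 := fun i =>
    calc (t * pderiv i w).totalDegree ≤ t.totalDegree + (pderiv i w).totalDegree := totalDegree_mul _ _
      _ ≤ t.totalDegree + (w.totalDegree - 1) := Nat.add_le_add_left (totalDegree_pderiv_le i w) _
      _ ≤ d - 1 := by omega
  have hker2 : rupOp φ (t * pderiv 0 w) (t * pderiv 1 w) = 0 := by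
    rw [hφt]; exact rupOp_powPair w t e
  -- `w` divides `C b * t * w_i` only if `b = 0`
  have hkey : ∀ b : F, (∀ i : Fin 2, w ∣ C b * (t * pderiv i w)) → b = 0 := by
    intro b hb
    by_contra hb0
    have hi : ∀ i : Fin 2, pderiv i w = 0 := by
      intro i
      rcases hwprime.dvd_or_dvd (hb i) with h | h
      · exact absurd (isUnit_of_dvd_unit h ((Ne.isUnit hb0).map C)) hwirr.not_isUnit
      · rcases hwprime.dvd_or_dvd h with h' | h'
        · exact absurd h' hwt
        · exact hwndvd i h'
    rcases hwgrad with h | h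
    · exact h (hi 0)
    · exact h (hi 1)
  rcases Nat.lt_or_ge 1 e with he2 | he1'
  · -- Case II: `e ≥ 2`, pairs `(φ_X, φ_Y)` and `(t w_X, t w_Y)`
    refine ⟨pderiv 0 φ, pderiv 1 φ, t * pderiv 0 w, t * pderiv 1 w,
      (totalDegree_pderiv_le 0 φ).trans (by omega), (totalDegree_pderiv_le 1 φ).trans (by omega),
      hdeg2 0, hdeg2 1, rupOp_pderiv_self φ, hker2, fun a b h1 h2 => ?_⟩
    -- `∂_i φ = w^{e-1} (e w_i t + w t_i)`
    have hfac : ∀ i : Fin 2, pderiv i φ = w ^ (e - 1) * ((e : MvPolynomial (Fin 2) F) *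
        pderiv i w * t + w * pderiv i t) := by
      intro i
      obtain ⟨e', rfl⟩ : ∃ e', e = e' + 1 := ⟨e - 1, by omega⟩
      rw [hφt, Derivation.leibniz, Derivation.leibniz_pow, smul_eq_mul, smul_eq_mul, nsmul_eq_mul,
        Nat.add_sub_cancel, pow_succ]
      push_cast
      ring
    have hb : b = 0 := by
      refine hkey b fun i => ?_
      have hi : a • pderiv i φ + b • (t * pderiv i w) = 0 := by
        fin_cases i
        · exact h1
        · exact h2
      rw [smul_eq_C_mul, smul_eq_C_mul, hfac i] at hi
      -- `C b * (t * w_i) = -(C a * w^{e-1} * (...))`, and `w ∣ w^{e-1}`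
      have : C b * (t * pderiv i w) = w * (-(C a * w ^ (e - 2) *
          ((e : MvPolynomial (Fin 2) F) * pderiv i w * t + w * pderiv i t))) := by
        obtain ⟨e', rfl⟩ : ∃ e', e = e' + 2 := ⟨e - 2, by omega⟩
        rw [Nat.add_sub_cancel, show e' + 2 - 1 = e' + 1 from rfl, pow_succ] at *
        linear_combination hi
      exact ⟨_, this⟩
    subst hb
    simp only [zero_smul, add_zero] at h1 h2
    rw [smul_eq_C_mul] at h1 h2
    have hφgrad := pderiv_ne_zero_of_totalDegree_pos hchar hpos hdeg
    refine ⟨?_, rfl⟩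
    by_contra ha
    have hCa : C a ≠ (0 : MvPolynomial (Fin 2) F) := by rwa [Ne, C_eq_zero]
    rcases hφgrad with h | h
    · exact h ((mul_eq_zero.mp h1).resolve_left hCa)
    · exact h ((mul_eq_zero.mp h2).resolve_left hCa)
  · -- Case I: `e = 1`, `φ = w t` with `w ∤ t`; pairs `(t w_X, t w_Y)` and `(w t_X, w t_Y)`
    have he : e = 1 := le_antisymm he1' he1
    subst he
    rw [pow_one] at hφt
    -- `t` is not constant (else `φ = w t` would be irreducible)
    have htpos : 0 < t.totalDegree := by
      by_contra h
      have h0 : t.totalDegree = 0 := by omega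
      obtain ⟨c, hc⟩ : ∃ c, t = C c := ⟨_, (totalDegree_eq_zero_iff_eq_C).mp h0⟩
      have hc0 : c ≠ 0 := by rintro rfl; exact ht0 (by rw [hc, C_0])
      apply hφ
      rw [hφt, hc, mul_comm]
      exact (irreducible_isUnit_mul ((Ne.isUnit hc0).map C)).mpr hwirr
    have htdeg : t.totalDegree ≤ d := by
      have := totalDegree_le_of_dvd_of_isDomain (⟨w, by rw [hφt, mul_comm]⟩ : t ∣ φ) hφ0
      omega
    have htgrad := pderiv_ne_zero_of_totalDegree_pos hchar htpos htdeg
    have hdeg1 : ∀ i : Fin 2, (w * pderiv i t).totalDegree ≤ d - 1 := fun i =>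
      calc (w * pderiv i t).totalDegree ≤ w.totalDegree + (pderiv i t).totalDegree :=
            totalDegree_mul _ _
        _ ≤ w.totalDegree + (t.totalDegree - 1) := Nat.add_le_add_left (totalDegree_pderiv_le i t) _
        _ ≤ d - 1 := by omega
    have hker1 : rupOp φ (w * pderiv 0 t) (w * pderiv 1 t) = 0 := by
      rw [hφt, mul_comm w t]; exact rupOp_logPair t w
    refine ⟨w * pderiv 0 t, w * pderiv 1 t, t * pderiv 0 w, t * pderiv 1 w, hdeg1 0, hdeg1 1,
      hdeg2 0, hdeg2 1, hker1, hker2, fun a b h1 h2 => ?_⟩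
    have hb : b = 0 := by
      refine hkey b fun i => ?_
      have hi : a • (w * pderiv i t) + b • (t * pderiv i w) = 0 := by
        fin_cases i
        · exact h1
        · exact h2
      rw [smul_eq_C_mul, smul_eq_C_mul] at hi
      exact ⟨-(C a * pderiv i t), by linear_combination hi⟩
    subst hb
    simp only [zero_smul, add_zero] at h1 h2
    rw [smul_eq_C_mul] at h1 h2
    refine ⟨?_, rfl⟩
    by_contra ha
    have hCa : C a ≠ (0 : MvPolynomial (Fin 2) F) := by rwa [Ne, C_eq_zero]
    rcases htgrad with h | h
    · exact h ((mul_eq_zero.mp ((mul_eq_zero.mp h1).resolve_left hCa)).resolve_left hw0)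
    · exact h ((mul_eq_zero.mp ((mul_eq_zero.mp h2).resolve_left hCa)).resolve_left hw0)

end Ruppert

end Literature.RingTheory.MvPolynomial

end
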